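/-
Copyright (c) 2026 the pub-hodgecm-mathlib formalisation cell (harness21).  Prover seat hodgecm-mathlib-K2E1-p07 (g2), Track B «K2-LIT», h413;
BY-NAME DEAL #5 of the dealer K2E1-plan (g0) (`K2/STATUS.md` 2026-09-03T23:33:45Z): the (H1♮) LEVEL-FAMILY edition, part 2 (the package).  2026-09-03.
-/
import Summits.HodgeConjecture.HodgeConjecture.Theorems.K2E1PoincareSeriesTestFunctionsLevel    -- part 1♮ (this seat): `exists_toCc_familyTensor`, `awayFactorLevel_*`
import Summits.HodgeConjecture.HodgeConjecture.Theorems.K2E1PoincareSeriesH1PackagePoincare    -- ★ p855494 (this seat): integral-level edition, `toLocal_mul_jhom_mul`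
import HarnessLib

/-!
# K2_E1 road (h413 = stmt-HodgeConjecture-24833), 5R route S2 — the (H1♮) PACKAGE for an ARBITRARY away-from-`v` level family `K₀`

Cell `pub/hodgecm-mathlib` (D-0151), Track B, dealt BY NAME by the dealer K2E1-plan (g0) (`K2/STATUS.md` 2026-09-03T23:33:45Z): the level-family
edition of ★ p855471 `K2E1PoincareSeriesH1Package` ∕ ★ p855494 `K2E1PoincareSeriesH1PackagePoincare`.  Those hard-wire the away-from-`v` levels of the
test function `φ_u = c_u ⊗ ⊗_{w ≠ v} 𝟙_{U(H)(𝒪_w)} ⊗ f_∞` to the integral levels; here `U(H)(𝒪_w) ↦ K₀ w` for any family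
`K₀ : ∀ w, Subgroup ((cmDatum L N H).Local w)` of compact open subgroups equal to `U(H)(𝒪_w)` off a finite set `S₀` (the node chain needs
`K₀ := cmGelfandLevel L`, ★ p855649, cofinitely integral by ★ `eventually_cmGelfandLevel_eq_cmLocalIntegralLevel`).  MAIN: `exists_h1Package_poincare_level`
— ★ p855494 `exists_h1Package_poincare` with the extra binders `S₀, hK₀, hK₀o, hK₀c`, the factorisation clause `φ y = Ψ^{K₀}_f y · B (ρ y_v u) u`, and
clause (c♮) `∀ w ≠ v, ∀ k ∈ K₀ w, R(j_w k) F = F`; the clauses `f` continuous ∕ compactly supported ∕ `f 1 = 1`, vanishing of `φ` on `U(H)(L⁺) ∖ {1}`,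
(a) `F ≠ 0`, (b) `R_v(e) F = F` and the definition of `F` are BYTE-IDENTICAL to ★ p855494.  Proofs = those of ★ p855471 ∕ p855494 with the substitution
(they only use that the levels are subgroups; the test function comes from part 1♮ `exists_toCc_familyTensor` ∕ `exists_archFactor_vanishing_level`).
THEOREMS ONLY (no `def`, no instance, no notation, no named fact, no `sorry`); lane `--supports stmt-HodgeConjecture-24833 --as helper`.

* §1 `familyLevel_translate` (`φ_x(j_v(h)⁻¹ z) = φ_{ρ(h)x}(z)`), `familyLevel_invariant` (`φ_x(j_w(k)⁻¹ z) = φ_x(z)`, `k ∈ K₀ w`, `w ≠ v`);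
* §2 `fiberIntegralVec_familyLevel_add ∕ _smul` (linearity of `x ↦ P_{φ_x}`); §1 also has `awayFactorLevel_mul_jhom_mul`;
* §3 `exists_h1Package_poincare_level`.

HONEST LABEL: HC_CM is proved only modulo the 7 printed citations (2 remaining named inputs: hLiu418 = stmt-HodgeConjecture-24832,
h413 = stmt-HodgeConjecture-24833) until rung 0 closes; this file is a `--supports stmt-HodgeConjecture-24833` helper and retires nothing by itself.

## References
* [Gelbart1975] S. Gelbart, *Automorphic forms on adele groups*, Ann. of Math. Stud. 83 (1975), §10 p. 153.
* [Rogawski1990] J. D. Rogawski, *Automorphic Representations of Unitary Groups in Three Variables*, Ann. of Math. Stud. 123 (1990), §13.8 p. 218 (i)–(iii).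
* [BorelJacquet1979] A. Borel, H. Jacquet, *Automorphic forms and automorphic representations*, PSPM 33.1 (1979), §4.1.
* [GetzHahn2024] J. R. Getz, H. Hahn, *An Introduction to Automorphic Representations*, GTM 300 (2024), §9.2, Thm. 5.5.1 p. 105.
-/

set_option autoImplicit false
-- justification (lint debt, as in every sibling `K2E1*` file): the mandated namespace `Summit.HodgeConjecture.HodgeConjecture.…` repeats a component.
set_option linter.dupNamespace false

noncomputable section

open MeasureTheory Filter Topology CompactlySupported NumberField IsDedekindDomain
open scoped ComplexConjugate Classical
open Literature.NumberTheory.Automorphic Literature.NumberTheory.Automorphic.UnitaryGroup Representation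
open Summit.HodgeConjecture.HodgeConjecture.Cruxes.H413.K2E1PoincareSeriesCompactSupport
open Summit.HodgeConjecture.HodgeConjecture.Cruxes.H413.K2E1PoincareSeriesTestFunctions
open Summit.HodgeConjecture.HodgeConjecture.Cruxes.H413.K2E1PoincareSeriesTestFunctionsLevel
open Summit.HodgeConjecture.HodgeConjecture.Cruxes.H413.K2E1SupercuspidalIdempotent
open Summit.HodgeConjecture.HodgeConjecture.Cruxes.H413.K2E1PoincareSeriesH1PackagePoincare (toLocal_mul_jhom_mul)

namespace Summit.HodgeConjecture.HodgeConjecture.Cruxes.H413.K2E1PoincareSeriesH1PackageLevel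

section H1

variable (L : Type) [Field L] [NumberField L] [IsCMField L] {N : ℕ} (H : Matrix (Fin N) (Fin N) L)
  (v : HeightOneSpectrum (𝓞 ↥(maximalRealSubfield L)))
  (K₀ : ∀ w : HeightOneSpectrum (𝓞 ↥(maximalRealSubfield L)), Subgroup ((cmDatum L N H).Local w))
  {V : Type} [AddCommGroup V] [Module ℂ V] {ρ : Representation ℂ ((cmDatum L N H).Local v) V} {B : V →ₗ⋆[ℂ] V →ₗ[ℂ] ℂ}
  (hBinv : ∀ (g : (cmDatum L N H).Local v) (x y : V), B (ρ g x) (ρ g y) = B x y) {u : V}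
  {f : arch (↥(maximalRealSubfield L)) L (IsCMField.complexConj L) N H → ℂ}
  (φ : V → C_c((cmDatum L N H).Adelic, ℂ))

/-! ## §1 The family `φ_x = c_x ⊗ ⊗_{w ≠ v} 𝟙_{K₀ w} ⊗ f`, `c_x(g) = B (ρ g u) x`: equivariance and `K₀ w`-invariance -/

include hBinv in
/-- **Equivariance of the family**: `φ_x(j_v(h)⁻¹ · z) = φ_{ρ(h) x}(z)` (`Ψ_f` is `j_v`-invariant, `(j_v h⁻¹ z)_v = h⁻¹ z_v`, and
`B (ρ (h⁻¹ g) u) x = B (ρ g u) (ρ h x)` by invariance of `B`). [cite: Gelbart1975, §10 p. 153] -/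
theorem familyLevel_translate
    (hφ : ∀ (x : V) (z : (cmDatum L N H).Adelic), φ x z = (if ∀ w, w ≠ v → (cmDatum L N H).toLocal w z ∈ K₀ w then
          f (UnitaryGroup.archPart (↥(maximalRealSubfield L)) L (IsCMField.complexConj L) N H z) else 0) * B (ρ ((cmDatum L N H).toLocal v z) u) x)
    (h : (cmDatum L N H).Local v) (x : V) :
    (fun z : (cmDatum L N H).Adelic => φ x (((((MonoidHom.id ((cmDatum L N H).Adelic)).comp ((inclPlaceAdelic (↥(maximalRealSubfield L)) L (IsCMField.complexConj L) N H v).comp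
        (localPiEquiv L (IsCMField.complexConj L) N H v).symm.toMulEquiv.toMonoidHom)).comp (MonoidHom.id ((cmDatum L N H).Local v))) h)⁻¹ * z)) = ⇑(φ (ρ h x)) := by
  have key : ∀ g : (cmDatum L N H).Local v, B (ρ (h⁻¹ * g) u) x = B (ρ g u) (ρ h x) := fun g => by
    rw [map_mul, Module.End.mul_apply, ← hBinv h (ρ h⁻¹ (ρ g u)) x, ← Module.End.mul_apply, ← map_mul, mul_inv_cancel, map_one,
      Module.End.one_apply]
  funext z
  rw [← map_inv, hφ, hφ, awayFactorLevel_jhom_mul L H v K₀, map_mul, toLocal_jhom_self, key]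

/-- **Invariance of the family under `K₀ w`, `w ≠ v`**: `φ_x(j_w(k)⁻¹ · z) = φ_x(z)` for `k ∈ K₀ w`. [cite: BorelJacquet1979, §4.1] -/
theorem familyLevel_invariant
    (hφ : ∀ (x : V) (z : (cmDatum L N H).Adelic), φ x z = (if ∀ w, w ≠ v → (cmDatum L N H).toLocal w z ∈ K₀ w then
          f (UnitaryGroup.archPart (↥(maximalRealSubfield L)) L (IsCMField.complexConj L) N H z) else 0) * B (ρ ((cmDatum L N H).toLocal v z) u) x)
    {w : HeightOneSpectrum (𝓞 ↥(maximalRealSubfield L))} (hw : w ≠ v) {k : (cmDatum L N H).Local w}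
    (hk : k ∈ K₀ w) (x : V) :
    (fun z : (cmDatum L N H).Adelic => φ x (((((MonoidHom.id ((cmDatum L N H).Adelic)).comp ((inclPlaceAdelic (↥(maximalRealSubfield L)) L (IsCMField.complexConj L) N H w).comp
        (localPiEquiv L (IsCMField.complexConj L) N H w).symm.toMulEquiv.toMonoidHom)).comp (MonoidHom.id ((cmDatum L N H).Local w))) k)⁻¹ * z)) = ⇑(φ x) := by
  funext z
  rw [← map_inv, hφ, hφ, awayFactorLevel_jhom_mul_of_mem L H v K₀ _ ((K₀ w).inv_mem hk), map_mul,
    toLocal_jhom_of_ne L H (Ne.symm hw), one_mul]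

/-- **`Ψ_f(x · j_v(g) · y) = Ψ_f(x · y)`** — the away-from-`v` factor does not see the `v`-coordinate in the middle either (coordinates off `v` and at
infinity are multiplicative and those of `j_v g` are trivial); with `toLocal_mul_jhom_mul` this makes the cusp-vanishing integrals `∫_{N_v} φ(x u⁻¹ y) du`
of (H2) factor through the local coefficient. [cite: BorelJacquet1979, §4.1] -/
theorem awayFactorLevel_mul_jhom_mul (f : arch (↥(maximalRealSubfield L)) L (IsCMField.complexConj L) N H → ℂ)
    (g : (cmDatum L N H).Local v) (x y : (cmDatum L N H).Adelic) :
    (if ∀ w, w ≠ v → (cmDatum L N H).toLocal w (x * (((MonoidHom.id ((cmDatum L N H).Adelic)).comp ((inclPlaceAdelic (↥(maximalRealSubfield L)) L (IsCMField.complexConj L) N H v).comp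
        (localPiEquiv L (IsCMField.complexConj L) N H v).symm.toMulEquiv.toMonoidHom)).comp (MonoidHom.id ((cmDatum L N H).Local v))) g * y) ∈ K₀ w then
          f (UnitaryGroup.archPart (↥(maximalRealSubfield L)) L (IsCMField.complexConj L) N H (x * (((MonoidHom.id ((cmDatum L N H).Adelic)).comp ((inclPlaceAdelic (↥(maximalRealSubfield L)) L (IsCMField.complexConj L) N H v).comp
        (localPiEquiv L (IsCMField.complexConj L) N H v).symm.toMulEquiv.toMonoidHom)).comp (MonoidHom.id ((cmDatum L N H).Local v))) g * y)) else 0) =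
      (if ∀ w, w ≠ v → (cmDatum L N H).toLocal w (x * y) ∈ K₀ w then
          f (UnitaryGroup.archPart (↥(maximalRealSubfield L)) L (IsCMField.complexConj L) N H (x * y)) else 0) := by
  have hcoord : ∀ w, w ≠ v → (cmDatum L N H).toLocal w (x * (((MonoidHom.id ((cmDatum L N H).Adelic)).comp ((inclPlaceAdelic (↥(maximalRealSubfield L)) L (IsCMField.complexConj L) N H v).comp
        (localPiEquiv L (IsCMField.complexConj L) N H v).symm.toMulEquiv.toMonoidHom)).comp (MonoidHom.id ((cmDatum L N H).Local v))) g * y) = (cmDatum L N H).toLocal w (x * y) := fun w hw => by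
    rw [map_mul, map_mul, toLocal_jhom_of_ne L H hw, mul_one, map_mul]
  have harch : UnitaryGroup.archPart (↥(maximalRealSubfield L)) L (IsCMField.complexConj L) N H (x * (((MonoidHom.id ((cmDatum L N H).Adelic)).comp ((inclPlaceAdelic (↥(maximalRealSubfield L)) L (IsCMField.complexConj L) N H v).comp
        (localPiEquiv L (IsCMField.complexConj L) N H v).symm.toMulEquiv.toMonoidHom)).comp (MonoidHom.id ((cmDatum L N H).Local v))) g * y) = UnitaryGroup.archPart (↥(maximalRealSubfield L)) L (IsCMField.complexConj L) N H (x * y) := by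
    have h2 : UnitaryGroup.archPart (↥(maximalRealSubfield L)) L (IsCMField.complexConj L) N H (x * (((MonoidHom.id ((cmDatum L N H).Adelic)).comp ((inclPlaceAdelic (↥(maximalRealSubfield L)) L (IsCMField.complexConj L) N H v).comp
        (localPiEquiv L (IsCMField.complexConj L) N H v).symm.toMulEquiv.toMonoidHom)).comp (MonoidHom.id ((cmDatum L N H).Local v))) g) = UnitaryGroup.archPart (↥(maximalRealSubfield L)) L (IsCMField.complexConj L) N H x := by
      have h := (UnitaryGroup.archPart (↥(maximalRealSubfield L)) L (IsCMField.complexConj L) N H).map_mul x ((((MonoidHom.id ((cmDatum L N H).Adelic)).comp ((inclPlaceAdelic (↥(maximalRealSubfield L)) L (IsCMField.complexConj L) N H v).comp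
        (localPiEquiv L (IsCMField.complexConj L) N H v).symm.toMulEquiv.toMonoidHom)).comp (MonoidHom.id ((cmDatum L N H).Local v))) g)
      rw [archPart_jhom, mul_one] at h
      exact h
    have h1 : UnitaryGroup.archPart (↥(maximalRealSubfield L)) L (IsCMField.complexConj L) N H (x * (((MonoidHom.id ((cmDatum L N H).Adelic)).comp ((inclPlaceAdelic (↥(maximalRealSubfield L)) L (IsCMField.complexConj L) N H v).comp
        (localPiEquiv L (IsCMField.complexConj L) N H v).symm.toMulEquiv.toMonoidHom)).comp (MonoidHom.id ((cmDatum L N H).Local v))) g * y) = UnitaryGroup.archPart (↥(maximalRealSubfield L)) L (IsCMField.complexConj L) N H (x * (((MonoidHom.id ((cmDatum L N H).Adelic)).comp ((inclPlaceAdelic (↥(maximalRealSubfield L)) L (IsCMField.complexConj L) N H v).comp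
        (localPiEquiv L (IsCMField.complexConj L) N H v).symm.toMulEquiv.toMonoidHom)).comp (MonoidHom.id ((cmDatum L N H).Local v))) g) * UnitaryGroup.archPart (↥(maximalRealSubfield L)) L (IsCMField.complexConj L) N H y :=
      (UnitaryGroup.archPart (↥(maximalRealSubfield L)) L (IsCMField.complexConj L) N H).map_mul _ _
    have h3 : UnitaryGroup.archPart (↥(maximalRealSubfield L)) L (IsCMField.complexConj L) N H (x * y) = UnitaryGroup.archPart (↥(maximalRealSubfield L)) L (IsCMField.complexConj L) N H x * UnitaryGroup.archPart (↥(maximalRealSubfield L)) L (IsCMField.complexConj L) N H y := (UnitaryGroup.archPart (↥(maximalRealSubfield L)) L (IsCMField.complexConj L) N H).map_mul _ _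
    rw [h1, h2, h3]
  rw [harch]
  have hiff : (∀ w, w ≠ v → (cmDatum L N H).toLocal w (x * (((MonoidHom.id ((cmDatum L N H).Adelic)).comp ((inclPlaceAdelic (↥(maximalRealSubfield L)) L (IsCMField.complexConj L) N H v).comp
        (localPiEquiv L (IsCMField.complexConj L) N H v).symm.toMulEquiv.toMonoidHom)).comp (MonoidHom.id ((cmDatum L N H).Local v))) g * y) ∈ K₀ w) ↔
      ∀ w, w ≠ v → (cmDatum L N H).toLocal w (x * y) ∈ K₀ w :=
    forall₂_congr fun w hw => by rw [hcoord w hw]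
  by_cases h : ∀ w, w ≠ v → (cmDatum L N H).toLocal w (x * y) ∈ K₀ w
  · rw [if_pos h, if_pos (hiff.2 h)]
  · rw [if_neg h, if_neg (fun h' => h (hiff.1 h'))]

variable [MeasurableSpace (cmDatum L N H).Adelic] [BorelSpace (cmDatum L N H).Adelic]
  (μH : Measure (cmDatum L N H).automorphicQuotient) [(cmDatum L N H).IsAutomorphicMeasure μH]

/-! ## §2 The Poincaré series `P_{φ_x}` (★ rung 1, counting measure on the discrete `U(H)(L⁺)`): linearity in `x` -/

/-- **`x ↦ P_{φ_x}` is additive** (pointwise: the fibre sums over the discrete `U(H)(L⁺)` are finite, ★ rung 1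
`fiberIntegralVec_quotientSubgroup_count_mk`, and `c_{x+y} = c_x + c_y`). [folklore] -/
theorem fiberIntegralVec_familyLevel_add
    (hφ : ∀ (x : V) (z : (cmDatum L N H).Adelic), φ x z = (if ∀ w, w ≠ v → (cmDatum L N H).toLocal w z ∈ K₀ w then
          f (UnitaryGroup.archPart (↥(maximalRealSubfield L)) L (IsCMField.complexConj L) N H z) else 0) * B (ρ ((cmDatum L N H).toLocal v z) u) x)
    (x y : V) :
    haveI := discreteTopology_quotientSubgroup_of_center'_eq_bot (cmDatum L N H) rfl (cmDatum_isDiscreteRational L N H)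
    haveI := countable_quotientSubgroup_of_center'_eq_bot (cmDatum L N H) rfl (cmDatum_isDiscreteRational L N H)
    haveI : IsClosed (((cmDatum L N H).quotientSubgroup : Subgroup (cmDatum L N H).Adelic) : Set (cmDatum L N H).Adelic) :=
      isClosed_quotientSubgroup_of_center'_eq_bot (cmDatum L N H) rfl (cmDatum_isDiscreteRational L N H)
    letI := (cmDatum L N H).measurableSpaceQuotientForm
    haveI := (cmDatum L N H).borelSpaceQuotientForm
    (fiberIntegralVec (cmDatum L N H).quotientSubgroup (Measure.count : Measure (cmDatum L N H).quotientSubgroup) (⇑(φ (x + y))) : (cmDatum L N H).automorphicQuotient → ℂ) = fiberIntegralVec (cmDatum L N H).quotientSubgroup (Measure.count : Measure (cmDatum L N H).quotientSubgroup) (⇑(φ x)) + fiberIntegralVec (cmDatum L N H).quotientSubgroup (Measure.count : Measure (cmDatum L N H).quotientSubgroup) (⇑(φ y)) := by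
  have hdisc : (cmDatum L N H).IsDiscreteRational := cmDatum_isDiscreteRational L N H
  haveI := discreteTopology_quotientSubgroup_of_center'_eq_bot (cmDatum L N H) rfl hdisc
  haveI := countable_quotientSubgroup_of_center'_eq_bot (cmDatum L N H) rfl hdisc
  haveI : IsClosed (((cmDatum L N H).quotientSubgroup : Subgroup (cmDatum L N H).Adelic) : Set (cmDatum L N H).Adelic) :=
    isClosed_quotientSubgroup_of_center'_eq_bot (cmDatum L N H) rfl hdisc
  haveI : IsFiniteMeasureOnCompacts (Measure.count : Measure (cmDatum L N H).quotientSubgroup) :=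
    ⟨fun _ hK => Measure.count_apply_lt_top.2 hK.finite_of_discrete⟩
  letI := (cmDatum L N H).measurableSpaceQuotientForm
  haveI := (cmDatum L N H).borelSpaceQuotientForm
  funext q
  induction q using QuotientGroup.induction_on with
  | H g =>
    rw [Pi.add_apply, fiberIntegralVec_quotientSubgroup_count_mk (cmDatum L N H) rfl hdisc (φ (x + y)) g,
      fiberIntegralVec_quotientSubgroup_count_mk (cmDatum L N H) rfl hdisc (φ x) g, fiberIntegralVec_quotientSubgroup_count_mk (cmDatum L N H) rfl hdisc (φ y) g,
      ← (summable_of_hasFiniteSupport (finite_support_fiber (cmDatum L N H).quotientSubgroup (φ x).hasCompactSupport g)).tsum_add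
        (summable_of_hasFiniteSupport (finite_support_fiber (cmDatum L N H).quotientSubgroup (φ y).hasCompactSupport g))]
    exact tsum_congr fun γ => by rw [hφ, hφ, hφ, map_add, mul_add]

/-- **`x ↦ P_{φ_x}` is homogeneous** (`c_{a x} = a c_x`). [folklore] -/
theorem fiberIntegralVec_familyLevel_smul
    (hφ : ∀ (x : V) (z : (cmDatum L N H).Adelic), φ x z = (if ∀ w, w ≠ v → (cmDatum L N H).toLocal w z ∈ K₀ w then
          f (UnitaryGroup.archPart (↥(maximalRealSubfield L)) L (IsCMField.complexConj L) N H z) else 0) * B (ρ ((cmDatum L N H).toLocal v z) u) x)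
    (a : ℂ) (x : V) :
    haveI := discreteTopology_quotientSubgroup_of_center'_eq_bot (cmDatum L N H) rfl (cmDatum_isDiscreteRational L N H)
    haveI := countable_quotientSubgroup_of_center'_eq_bot (cmDatum L N H) rfl (cmDatum_isDiscreteRational L N H)
    haveI : IsClosed (((cmDatum L N H).quotientSubgroup : Subgroup (cmDatum L N H).Adelic) : Set (cmDatum L N H).Adelic) :=
      isClosed_quotientSubgroup_of_center'_eq_bot (cmDatum L N H) rfl (cmDatum_isDiscreteRational L N H)
    letI := (cmDatum L N H).measurableSpaceQuotientForm
    haveI := (cmDatum L N H).borelSpaceQuotientForm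
    (fiberIntegralVec (cmDatum L N H).quotientSubgroup (Measure.count : Measure (cmDatum L N H).quotientSubgroup) (⇑(φ (a • x))) : (cmDatum L N H).automorphicQuotient → ℂ) = a • fiberIntegralVec (cmDatum L N H).quotientSubgroup (Measure.count : Measure (cmDatum L N H).quotientSubgroup) (⇑(φ x)) := by
  have hdisc : (cmDatum L N H).IsDiscreteRational := cmDatum_isDiscreteRational L N H
  haveI := discreteTopology_quotientSubgroup_of_center'_eq_bot (cmDatum L N H) rfl hdisc
  haveI := countable_quotientSubgroup_of_center'_eq_bot (cmDatum L N H) rfl hdisc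
  haveI : IsClosed (((cmDatum L N H).quotientSubgroup : Subgroup (cmDatum L N H).Adelic) : Set (cmDatum L N H).Adelic) :=
    isClosed_quotientSubgroup_of_center'_eq_bot (cmDatum L N H) rfl hdisc
  haveI : IsFiniteMeasureOnCompacts (Measure.count : Measure (cmDatum L N H).quotientSubgroup) :=
    ⟨fun _ hK => Measure.count_apply_lt_top.2 hK.finite_of_discrete⟩
  letI := (cmDatum L N H).measurableSpaceQuotientForm
  haveI := (cmDatum L N H).borelSpaceQuotientForm
  funext q
  induction q using QuotientGroup.induction_on with
  | H g =>
    rw [Pi.smul_apply, fiberIntegralVec_quotientSubgroup_count_mk (cmDatum L N H) rfl hdisc (φ (a • x)) g,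
      fiberIntegralVec_quotientSubgroup_count_mk (cmDatum L N H) rfl hdisc (φ x) g, smul_eq_mul, ← tsum_mul_left]
    exact tsum_congr fun γ => by rw [hφ, hφ, map_smul, smul_eq_mul, mul_left_comm]

/-! ## §3 The (H1) package -/

variable [NonarchimedeanGroup ((cmDatum L N H).Local v)] [LocallyCompactSpace ((cmDatum L N H).Local v)] [T2Space ((cmDatum L N H).Local v)]
  [MeasurableSpace ((cmDatum L N H).Local v)] [BorelSpace ((cmDatum L N H).Local v)]
  [ρ.IsIrreducible] (hadm : ρ.IsAdmissible) (hsc : ρ.IsSupercuspidal)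
  (hZ : IsCompact (Subgroup.center ((cmDatum L N H).Local v) : Set ((cmDatum L N H).Local v)))
  (hBsymm : B.IsSymm) (hBpos : ∀ x : V, x ≠ 0 → 0 < (B x x).re)
  (ν : Measure ((cmDatum L N H).Local v)) [ν.IsHaarMeasure] [ν.IsInvInvariant] (hu : u ≠ 0)
  (e : C_c((cmDatum L N H).Local v, ℂ)) (he : ∀ g, e g = ((((∫ y, ‖B (ρ y u) u‖ ^ 2 ∂ν) / (B u u).re : ℝ) : ℂ))⁻¹ * B (ρ g u) u)

include hadm hsc hZ hBsymm hBpos hBinv hu he in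
/-- **The (H1) package with the test function exposed** (docking edition; see the module docstring): `∃ f φ`, `f` a continuous compactly
supported archimedean factor with `f(1) = 1`, `φ = c_u ⊗ ⊗_{w ≠ v} 𝟙_{K₀ w} ⊗ f ∈ C_c(U(H)(𝔸_{L⁺}))` (as the pointwise FACTORISATION
`φ(y) = Ψ_f(y) · B (ρ y_v u) u`), `φ(γ) = 0` on `U(H)(L⁺) ∖ {1}`, and for `F := (memLp_fiberIntegralVec_quotientSubgroup … φ 2).toLp (P_φ)`: `F ≠ 0`,
`R_v(e) F = F`, `R(j_w k) F = F` for `k ∈ K₀ w`, `w ≠ v` — the LEVEL-FAMILY edition (H1♮) of ★ p855494. [cite: Gelbart1975, §10 p. 153] [cite: Rogawski1990, §13.8 p. 218 (i)–(iii)] -/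
theorem exists_h1Package_poincare_level
    (hjv : Continuous
      (((MonoidHom.id ((cmDatum L N H).Adelic)).comp ((inclPlaceAdelic (↥(maximalRealSubfield L)) L (IsCMField.complexConj L) N H v).comp
        (localPiEquiv L (IsCMField.complexConj L) N H v).symm.toMulEquiv.toMonoidHom)).comp (MonoidHom.id ((cmDatum L N H).Local v))))
    (S₀ : Finset (HeightOneSpectrum (𝓞 ↥(maximalRealSubfield L)))) (hK₀ : ∀ w ∉ S₀, K₀ w = cmLocalIntegralLevel L N H w)
    (hK₀o : ∀ w, IsOpen (K₀ w : Set ((cmDatum L N H).Local w))) (hK₀c : ∀ w, IsCompact (K₀ w : Set ((cmDatum L N H).Local w))) :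
    haveI := discreteTopology_quotientSubgroup_of_center'_eq_bot (cmDatum L N H) rfl (cmDatum_isDiscreteRational L N H)
    haveI := countable_quotientSubgroup_of_center'_eq_bot (cmDatum L N H) rfl (cmDatum_isDiscreteRational L N H)
    haveI : IsClosed (((cmDatum L N H).quotientSubgroup : Subgroup (cmDatum L N H).Adelic) : Set (cmDatum L N H).Adelic) :=
      isClosed_quotientSubgroup_of_center'_eq_bot (cmDatum L N H) rfl (cmDatum_isDiscreteRational L N H)
    haveI : IsFiniteMeasureOnCompacts (Measure.count : Measure (cmDatum L N H).quotientSubgroup) :=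
      ⟨fun _ hK => Measure.count_apply_lt_top.2 hK.finite_of_discrete⟩
    letI := (cmDatum L N H).measurableSpaceQuotientForm
    haveI := (cmDatum L N H).borelSpaceQuotientForm
    ∃ (f : arch (↥(maximalRealSubfield L)) L (IsCMField.complexConj L) N H → ℂ) (φ : C_c((cmDatum L N H).Adelic, ℂ)),
      Continuous f ∧ HasCompactSupport f ∧ f 1 = 1 ∧
      (∀ y : (cmDatum L N H).Adelic, φ y = (if ∀ w, w ≠ v → (cmDatum L N H).toLocal w y ∈ K₀ w then
          f (UnitaryGroup.archPart (↥(maximalRealSubfield L)) L (IsCMField.complexConj L) N H y) else 0) * B (ρ ((cmDatum L N H).toLocal v y) u) u) ∧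
      (∀ γ : (cmDatum L N H).Adelic, γ ∈ (cmDatum L N H).quotientSubgroup → γ ≠ 1 → φ γ = 0) ∧
      (memLp_fiberIntegralVec_quotientSubgroup (cmDatum L N H) μH (Measure.count : Measure (cmDatum L N H).quotientSubgroup) φ 2).toLp _ ≠ 0 ∧
      (((cmDatum L N H).rightRegular μH).restrict
          (((MonoidHom.id ((cmDatum L N H).Adelic)).comp ((inclPlaceAdelic (↥(maximalRealSubfield L)) L (IsCMField.complexConj L) N H v).comp
        (localPiEquiv L (IsCMField.complexConj L) N H v).symm.toMulEquiv.toMonoidHom)).comp (MonoidHom.id ((cmDatum L N H).Local v)))).integratedOperator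
        (((cmDatum L N H).isUnitary_rightRegular μH).restrict
          (((MonoidHom.id ((cmDatum L N H).Adelic)).comp ((inclPlaceAdelic (↥(maximalRealSubfield L)) L (IsCMField.complexConj L) N H v).comp
        (localPiEquiv L (IsCMField.complexConj L) N H v).symm.toMulEquiv.toMonoidHom)).comp (MonoidHom.id ((cmDatum L N H).Local v))))
        (((cmDatum L N H).isStronglyContinuous_rightRegular_holds μH).restrict
          (((MonoidHom.id ((cmDatum L N H).Adelic)).comp ((inclPlaceAdelic (↥(maximalRealSubfield L)) L (IsCMField.complexConj L) N H v).comp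
        (localPiEquiv L (IsCMField.complexConj L) N H v).symm.toMulEquiv.toMonoidHom)).comp (MonoidHom.id ((cmDatum L N H).Local v))) hjv) ν e
        ((memLp_fiberIntegralVec_quotientSubgroup (cmDatum L N H) μH (Measure.count : Measure (cmDatum L N H).quotientSubgroup) φ 2).toLp _) =
        (memLp_fiberIntegralVec_quotientSubgroup (cmDatum L N H) μH (Measure.count : Measure (cmDatum L N H).quotientSubgroup) φ 2).toLp _ ∧
      ∀ w, w ≠ v → ∀ k ∈ K₀ w, (cmDatum L N H).rightRegular μH
            ((((MonoidHom.id ((cmDatum L N H).Adelic)).comp ((inclPlaceAdelic (↥(maximalRealSubfield L)) L (IsCMField.complexConj L) N H w).comp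
        (localPiEquiv L (IsCMField.complexConj L) N H w).symm.toMulEquiv.toMonoidHom)).comp (MonoidHom.id ((cmDatum L N H).Local w))) k)
          ((memLp_fiberIntegralVec_quotientSubgroup (cmDatum L N H) μH (Measure.count : Measure (cmDatum L N H).quotientSubgroup) φ 2).toLp _) =
          (memLp_fiberIntegralVec_quotientSubgroup (cmDatum L N H) μH (Measure.count : Measure (cmDatum L N H).quotientSubgroup) φ 2).toLp _ := by
  have hdisc : (cmDatum L N H).IsDiscreteRational := cmDatum_isDiscreteRational L N H
  haveI := discreteTopology_quotientSubgroup_of_center'_eq_bot (cmDatum L N H) rfl hdisc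
  haveI := countable_quotientSubgroup_of_center'_eq_bot (cmDatum L N H) rfl hdisc
  haveI : IsClosed (((cmDatum L N H).quotientSubgroup : Subgroup (cmDatum L N H).Adelic) : Set (cmDatum L N H).Adelic) :=
    isClosed_quotientSubgroup_of_center'_eq_bot (cmDatum L N H) rfl hdisc
  haveI : IsFiniteMeasureOnCompacts (Measure.count : Measure (cmDatum L N H).quotientSubgroup) :=
    ⟨fun _ hK => Measure.count_apply_lt_top.2 hK.finite_of_discrete⟩
  letI := (cmDatum L N H).measurableSpaceQuotientForm
  haveI := (cmDatum L N H).borelSpaceQuotientForm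
  have hsm : ρ.IsSmooth := hadm.isSmooth
  have hcc : ∀ x : V, Continuous fun g : (cmDatum L N H).Local v => B (ρ g u) x := fun x =>
    continuous_sesqForm_apply_apply' hBsymm (hsm u) x
  have hccs : ∀ x : V, HasCompactSupport fun g : (cmDatum L N H).Local v => B (ρ g u) x := fun x =>
    hsc.hasCompactSupport_sesqForm_apply_apply' hZ hsm hBinv u x
  obtain ⟨f, hfc, hfs, hf1, hvan⟩ := exists_archFactor_vanishing_level L H v K₀ S₀ hK₀ hK₀o hK₀c (hcc u) (hccs u)
  choose φ hφ using fun x : V => exists_toCc_familyTensor L H v K₀ S₀ hK₀ hK₀o hK₀c (hcc x) (hccs x) hfc hfs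
  have hφ' : ∀ (x : V) (z : (cmDatum L N H).Adelic), φ x z = (if ∀ w, w ≠ v → (cmDatum L N H).toLocal w z ∈ K₀ w then
          f (UnitaryGroup.archPart (↥(maximalRealSubfield L)) L (IsCMField.complexConj L) N H z) else 0) * B (ρ ((cmDatum L N H).toLocal v z) u) x := hφ
  have hP : ∀ x : V, MemLp (fiberIntegralVec (cmDatum L N H).quotientSubgroup (Measure.count : Measure (cmDatum L N H).quotientSubgroup) (⇑(φ x)) : (cmDatum L N H).automorphicQuotient → ℂ) 2 μH := fun x =>
    memLp_fiberIntegralVec_quotientSubgroup (cmDatum L N H) μH Measure.count (φ x) 2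
  let T : V →ₗ[ℂ] (cmDatum L N H).L2 μH :=
    { toFun := fun x => (hP x).toLp _
      map_add' := fun x y => by
        refine Lp.ext_iff.2 ?_
        have h2 : (fiberIntegralVec (cmDatum L N H).quotientSubgroup (Measure.count : Measure (cmDatum L N H).quotientSubgroup) (⇑(φ (x + y))) : (cmDatum L N H).automorphicQuotient → ℂ) =ᵐ[μH] fiberIntegralVec (cmDatum L N H).quotientSubgroup (Measure.count : Measure (cmDatum L N H).quotientSubgroup) (⇑(φ x)) + fiberIntegralVec (cmDatum L N H).quotientSubgroup (Measure.count : Measure (cmDatum L N H).quotientSubgroup) (⇑(φ y)) :=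
          Eventually.of_forall fun q => congrFun (fiberIntegralVec_familyLevel_add L H v K₀ φ hφ' x y) q
        exact (hP (x + y)).coeFn_toLp.trans (h2.trans (((hP x).coeFn_toLp.symm.add (hP y).coeFn_toLp.symm).trans (Lp.coeFn_add _ _).symm))
      map_smul' := fun a x => by
        refine Lp.ext_iff.2 ?_
        have h2 : (fiberIntegralVec (cmDatum L N H).quotientSubgroup (Measure.count : Measure (cmDatum L N H).quotientSubgroup) (⇑(φ (a • x))) : (cmDatum L N H).automorphicQuotient → ℂ) =ᵐ[μH] a • fiberIntegralVec (cmDatum L N H).quotientSubgroup (Measure.count : Measure (cmDatum L N H).quotientSubgroup) (⇑(φ x)) :=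
          Eventually.of_forall fun q => congrFun (fiberIntegralVec_familyLevel_smul L H v K₀ φ hφ' a x) q
        exact (hP (a • x)).coeFn_toLp.trans (h2.trans (((hP x).coeFn_toLp.symm.const_smul a).trans (Lp.coeFn_smul _ _).symm)) }
  have hT : ∀ x, T x = (hP x).toLp _ := fun _ => rfl
  have hinter : ∀ (h : (cmDatum L N H).Local v) (x : V), T (ρ h x) =
      (((cmDatum L N H).rightRegular μH).restrict
        (((MonoidHom.id ((cmDatum L N H).Adelic)).comp ((inclPlaceAdelic (↥(maximalRealSubfield L)) L (IsCMField.complexConj L) N H v).comp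
        (localPiEquiv L (IsCMField.complexConj L) N H v).symm.toMulEquiv.toMonoidHom)).comp (MonoidHom.id ((cmDatum L N H).Local v)))) h (T x) := by
    intro h x
    rw [ContRepresentation.restrict_apply_apply, hT, hT]
    have hfun := familyLevel_translate L H v K₀ hBinv φ hφ' h x
    have hP' : MemLp (fiberIntegralVec (cmDatum L N H).quotientSubgroup (Measure.count : Measure (cmDatum L N H).quotientSubgroup) (fun z : (cmDatum L N H).Adelic => φ x (((((MonoidHom.id ((cmDatum L N H).Adelic)).comp ((inclPlaceAdelic (↥(maximalRealSubfield L)) L (IsCMField.complexConj L) N H v).comp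
        (localPiEquiv L (IsCMField.complexConj L) N H v).symm.toMulEquiv.toMonoidHom)).comp (MonoidHom.id ((cmDatum L N H).Local v))) h)⁻¹ * z)) : (cmDatum L N H).automorphicQuotient → ℂ) 2 μH := by
      rw [hfun]; exact hP (ρ h x)
    rw [rightRegular_toLp_fiberIntegralVec (cmDatum L N H) μH Measure.count _ (⇑(φ x)) (hP x) hP']
    exact MemLp.toLp_congr _ _ (Eventually.of_forall fun q => by rw [hfun])
  have hvan' : ∀ γ : (cmDatum L N H).Adelic, γ ∈ (cmDatum L N H).quotientSubgroup → γ ≠ 1 → φ u γ = 0 := fun γ hγ hγ1 => by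
    rw [hφ']; exact hvan γ hγ hγ1
  refine ⟨f, φ u, hfc, hfs, hf1, hφ' u, hvan', ?_, ?_, fun w hw k hk => ?_⟩
  · -- `P_{φ_u} ≠ 0`
    refine toLp_fiberIntegralVec_quotientSubgroup_ne_zero (cmDatum L N H) μH Measure.count (φ u) 2 (x := QuotientGroup.mk 1) ?_
    refine ne_of_eq_of_ne (fiberIntegralVec_quotientSubgroup_count_mk (cmDatum L N H) rfl hdisc (φ u) 1) ?_
    have h1val : φ u 1 = B u u := by
      rw [hφ', awayFactorLevel_one L H v K₀, hf1, one_mul, map_one, map_one, Module.End.one_apply]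
    rw [tsum_eq_single (1 : (cmDatum L N H).quotientSubgroup) (fun γ hγ => by
        rw [one_mul]; exact hvan' γ γ.2 (fun h => hγ (Subtype.ext h))),
      OneMemClass.coe_one, one_mul, h1val]
    exact fun h => (hBpos u hu).ne' (by rw [h, Complex.zero_re])
  · -- `R_v(e) P_{φ_u} = P_{φ_u}` (★ p855188 on the intertwiner `T`, `T u = P_{φ_u}`)
    exact integratedOperator_idempotent_apply_intertwiner hadm hsc hZ hBsymm hBpos hBinv ν hu e he _ _ T hinter
  · -- `U(H)(𝒪_w)`-invariance
    have hfun := familyLevel_invariant L H v K₀ φ hφ' hw hk u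
    have hP' : MemLp (fiberIntegralVec (cmDatum L N H).quotientSubgroup (Measure.count : Measure (cmDatum L N H).quotientSubgroup) (fun z : (cmDatum L N H).Adelic => φ u (((((MonoidHom.id ((cmDatum L N H).Adelic)).comp ((inclPlaceAdelic (↥(maximalRealSubfield L)) L (IsCMField.complexConj L) N H w).comp
        (localPiEquiv L (IsCMField.complexConj L) N H w).symm.toMulEquiv.toMonoidHom)).comp (MonoidHom.id ((cmDatum L N H).Local w))) k)⁻¹ * z)) : (cmDatum L N H).automorphicQuotient → ℂ) 2 μH := by
      rw [hfun]; exact hP u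
    rw [rightRegular_toLp_fiberIntegralVec (cmDatum L N H) μH Measure.count _ (⇑(φ u)) (hP u) hP']
    exact MemLp.toLp_congr _ _ (Eventually.of_forall fun q => by rw [hfun])

end H1

end Summit.HodgeConjecture.HodgeConjecture.Cruxes.H413.K2E1PoincareSeriesH1PackageLevel

end
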